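import Summits.ABC.ABC.Theses.DefiniteXi
import HarnessLib

/-!
# Crux `SteinbergCore` (stmt-ABC-15024), line Sketch — the general ledger glue

Helper for the crux `Summit.ABC.ABC.Theses.DefiniteXi.SteinbergCore` (stmt-ABC-15024), line `Sketch`
(card `steinberg-linvariant-slice`): the composition step of the line, proved once for an ARBITRARY
on-level selector and an ARBITRARY ledger, so that every ledger-type line of the crux programme inherits it.

Notation (all inline, no definitions): for coprime `a, b` with `ab(a+b) ≠ 0`, `N` the conductor of the Frey
curve `E_(a,b) = freyCurve a b` and an admissible quarantine `Nm` (odd, squarefree, `ω(Nm)` odd, `Nm ∣ N`),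
`ξ = brandtXi (N/Nm) Nm (a_n(E_(a,b)))`, `cps ξ = ξ / (2^{v₂ ξ} 3^{v₃ ξ})` (the prime-to-`6` part, as in the
route decl) and `P = ∏_{q ∣ N} v_q(Δ_min(E_(a,b)))`.  The crux reads `cps ξ · P ≤ C_ε N^(2+ε)`.

* `steinbergCore_of_ledgerSplit` — for any functions `on, cap` of `(a, b, N, Nm)` with `on ∣ cps ξ`:
  if `on ≤ C_ε N^ε · cap` ("slice excess") and `(cps ξ / on) · cap · P ≤ C_ε N^(2+ε)` ("ledger core") at
  every admissible datum, then `SteinbergCore` (pure algebra: `cps ξ = on · (cps ξ / on)` exactly, and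
  `N^(ε/2) · N^(2+ε/2) = N^(2+ε)`; the pattern of `DefiniteXi.closes`, Step 1);
* `ledgerCore_of_steinbergCore` — conversely, for any `on ∣ cps ξ` and any `cap ≤ on` pointwise,
  `SteinbergCore` implies the ledger core (so the residual stub of such a line is always implied by the
  crux: it is crux-sized by construction unless the cap carries information);
* `prod_ordProj_dvd_of_forall` / `prod_ordProj_dvd_div_six` — the on-level selector of the card,
  `on = ∏_{ℓ ∈ S} ℓ^{v_ℓ ξ}` over a finset `S` avoiding `2` and `3` (e.g. the primes `ℓ ∣ Nm`, `ℓ ≥ 5`),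
  divides `cps ξ`.
No new definitions; nothing here is specific to the card's Wieferich ledger.
-/

-- `Summit.<Summit>.<Problem>` is the mandated summit-side namespace (CONVENTIONS §2); for the single-conjunct
-- summit `ABC` the two coincide, so the duplicate `ABC.ABC` is deliberate.
set_option linter.dupNamespace false

namespace Summit.ABC.ABC.Theorems

open Literature.NumberTheory.EllipticCurves Literature.NumberTheory.Automorphic

/-! ### Products of prime-power parts divide the prime-to-6 part -/

/-- `∏_{ℓ ∈ S} ℓ^{v_ℓ n} ∣ n` for every finset `S` of naturals (factors off the support of the
factorization are `1`; for `n = 0` everything divides `0`). -/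
theorem prod_ordProj_dvd_of_forall (n : ℕ) (S : Finset ℕ) : ∏ ℓ ∈ S, ordProj[ℓ] n ∣ n := by
  rcases Nat.eq_zero_or_pos n with h0 | hpos
  · subst h0; exact dvd_zero _
  · have hself : ∏ p ∈ n.primeFactors, ordProj[p] n = n := by
      conv_rhs => rw [← Nat.prod_factorization_pow_eq_self hpos.ne']
      rw [Finsupp.prod, Nat.support_factorization]
    have hoff : ∀ x ∈ S, x ∉ S ∩ n.primeFactors → ordProj[x] n = 1 := by
      intro x hxS hxnot
      have hx : x ∉ n.primeFactors := fun h => hxnot (Finset.mem_inter.mpr ⟨hxS, h⟩)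
      have : n.factorization x = 0 := by
        by_contra hne
        exact hx (by rw [← Nat.support_factorization]; exact Finsupp.mem_support_iff.mpr hne)
      simp [this]
    calc ∏ ℓ ∈ S, ordProj[ℓ] n = ∏ ℓ ∈ S ∩ n.primeFactors, ordProj[ℓ] n :=
          (Finset.prod_subset Finset.inter_subset_left hoff).symm
      _ ∣ ∏ p ∈ n.primeFactors, ordProj[p] n :=
          Finset.prod_dvd_prod_of_subset _ _ _ Finset.inter_subset_right
      _ = n := hself

/-- `∏_{ℓ ∈ S} ℓ^{v_ℓ n}` divides the prime-to-`6` part `n / (2^{v₂ n} 3^{v₃ n})` whenever the finset `S`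
avoids `2` and `3` (assemble the product over `insert 2 (insert 3 S)` and divide). -/
theorem prod_ordProj_dvd_div_six (n : ℕ) (S : Finset ℕ) (h2 : 2 ∉ S) (h3 : 3 ∉ S) :
    ∏ ℓ ∈ S, ordProj[ℓ] n ∣ n / (ordProj[2] n * ordProj[3] n) := by
  rcases Nat.eq_zero_or_pos n with h0 | hpos
  · subst h0; simp
  · apply Nat.dvd_div_of_mul_dvd
    have h2' : (2 : ℕ) ∉ insert 3 S := by
      rw [Finset.mem_insert]
      rintro (h | h)
      · norm_num at h
      · exact h2 h
    have key := prod_ordProj_dvd_of_forall n (insert 2 (insert 3 S))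
    rw [Finset.prod_insert h2', Finset.prod_insert h3, ← mul_assoc] at key
    exact key

/-- The card's selector: the on-level part `∏_{ℓ ∣ Nm, ℓ ≥ 5} ℓ^{v_ℓ ξ}` divides `cps ξ`. -/
theorem prod_filter_five_le_ordProj_dvd_div_six (n Nm : ℕ) :
    ∏ ℓ ∈ Nm.primeFactors.filter (5 ≤ ·), ordProj[ℓ] n ∣ n / (ordProj[2] n * ordProj[3] n) :=
  prod_ordProj_dvd_div_six n _ (fun h => by have := (Finset.mem_filter.mp h).2; omega)
    (fun h => by have := (Finset.mem_filter.mp h).2; omega)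

/-! ### The general ledger glue -/

/-- **General ledger glue for `SteinbergCore`.**  Let `on, cap` be any functions of the datum
`(a, b, N, Nm)` with `on a b N Nm ∣ cps ξ`.  If for every `ε > 0` there are constants with
`on ≤ C N^ε · cap` (slice excess) and `(cps ξ / on) · cap · ∏_{q∣N} v_q(Δ_min) ≤ C N^(2+ε)` (ledger core)
at every admissible datum, then `SteinbergCore`.  Pure algebra: `cps ξ = on · (cps ξ / on)` (exact division),
constants replaced by `max(·, 0)`, and `N^(ε/2) · N^(2+ε/2) = N^(2+ε)` for `N ≥ 1`. -/
theorem steinbergCore_of_ledgerSplit :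
    ∀ (on cap : ℤ → ℤ → ℕ → ℕ → ℕ), (∀ (a b : ℤ) (N Nm : ℕ), on a b N Nm ∣
      Literature.NumberTheory.Automorphic.brandtXi (N / Nm) Nm
          (fun n => (Literature.NumberTheory.EllipticCurves.freyCurve a b).LFunction n) /
        (ordProj[2] (Literature.NumberTheory.Automorphic.brandtXi (N / Nm) Nm
            (fun n => (Literature.NumberTheory.EllipticCurves.freyCurve a b).LFunction n)) *
          ordProj[3] (Literature.NumberTheory.Automorphic.brandtXi (N / Nm) Nm
            (fun n => (Literature.NumberTheory.EllipticCurves.freyCurve a b).LFunction n)))) →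
    (∀ ε : ℝ, 0 < ε → ∃ C : ℝ, ∀ a b : ℤ, IsCoprime a b → a * b * (a + b) ≠ 0 → ∀ (N : ℕ) [NeZero N],
      (Literature.NumberTheory.EllipticCurves.freyCurve a b).conductorNorm ℤ = N → ∀ Nm : ℕ, Odd Nm →
      Squarefree Nm → Odd Nm.primeFactors.card → Nm ∣ N →
        ((on a b N Nm : ℕ) : ℝ) ≤ C * (N : ℝ) ^ ε * ((cap a b N Nm : ℕ) : ℝ)) →
    (∀ ε : ℝ, 0 < ε → ∃ C : ℝ, ∀ a b : ℤ, IsCoprime a b → a * b * (a + b) ≠ 0 → ∀ (N : ℕ) [NeZero N],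
      (Literature.NumberTheory.EllipticCurves.freyCurve a b).conductorNorm ℤ = N → ∀ Nm : ℕ, Odd Nm →
      Squarefree Nm → Odd Nm.primeFactors.card → Nm ∣ N →
        ((Literature.NumberTheory.Automorphic.brandtXi (N / Nm) Nm
                  (fun n => (Literature.NumberTheory.EllipticCurves.freyCurve a b).LFunction n) /
                (ordProj[2] (Literature.NumberTheory.Automorphic.brandtXi (N / Nm) Nm
                    (fun n => (Literature.NumberTheory.EllipticCurves.freyCurve a b).LFunction n)) *
                  ordProj[3] (Literature.NumberTheory.Automorphic.brandtXi (N / Nm) Nm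
                    (fun n => (Literature.NumberTheory.EllipticCurves.freyCurve a b).LFunction n))) /
              on a b N Nm : ℕ) : ℝ) * ((cap a b N Nm : ℕ) : ℝ) *
            ((∏ q ∈ N.primeFactors,
                ((Literature.NumberTheory.EllipticCurves.freyCurve a b).minimalDiscriminantNorm ℤ).factorization
                  q : ℕ) : ℝ) ≤ C * (N : ℝ) ^ (2 + ε)) →
    Summit.ABC.ABC.Theses.DefiniteXi.SteinbergCore := by
  intro on cap hdvd hS hL ε hε
  obtain ⟨C₁, hC₁⟩ := hS (ε / 2) (by linarith)
  obtain ⟨C₂, hC₂⟩ := hL (ε / 2) (by linarith)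
  refine ⟨max C₁ 0 * max C₂ 0, ?_⟩
  intro a b hab h0 N _ hN Nm hodd hsq hcard hdv
  have hA' := hC₁ a b hab h0 N hN Nm hodd hsq hcard hdv
  have hB' := hC₂ a b hab h0 N hN Nm hodd hsq hcard hdv
  set ξ : ℕ := brandtXi (N / Nm) Nm (fun n => (freyCurve a b).LFunction n) with hξ
  set x : ℕ := ξ / (ordProj[2] ξ * ordProj[3] ξ) with hx
  set d : ℕ := on a b N Nm with hd
  set e : ℕ := cap a b N Nm with he
  set P : ℕ := ∏ q ∈ N.primeFactors, ((freyCurve a b).minimalDiscriminantNorm ℤ).factorization q with hP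
  have hNpos : (0 : ℝ) < (N : ℝ) := by exact_mod_cast Nat.pos_of_ne_zero (NeZero.ne N)
  have hsplit : ((x : ℕ) : ℝ) = (d : ℝ) * ((x / d : ℕ) : ℝ) := by
    have : d * (x / d) = x := Nat.mul_div_cancel' (hdvd a b N Nm)
    exact_mod_cast this.symm
  have hc : (0 : ℝ) ≤ ((x / d : ℕ) : ℝ) := by positivity
  have hPnn : (0 : ℝ) ≤ (P : ℝ) := by positivity
  have henn : (0 : ℝ) ≤ (e : ℝ) := by positivity
  have hrpow1 : (0 : ℝ) ≤ (N : ℝ) ^ (ε / 2) := Real.rpow_nonneg hNpos.le _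
  have hrpow2 : (0 : ℝ) ≤ (N : ℝ) ^ (2 + ε / 2) := Real.rpow_nonneg hNpos.le _
  have hC₁0 : (0 : ℝ) ≤ max C₁ 0 := le_max_right _ _
  have hC₂0 : (0 : ℝ) ≤ max C₂ 0 := le_max_right _ _
  have hA'' : (d : ℝ) ≤ max C₁ 0 * (N : ℝ) ^ (ε / 2) * (e : ℝ) :=
    hA'.trans (by gcongr; exact le_max_left _ _)
  have hB'' : ((x / d : ℕ) : ℝ) * (e : ℝ) * (P : ℝ) ≤ max C₂ 0 * (N : ℝ) ^ (2 + ε / 2) :=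
    hB'.trans (by gcongr; exact le_max_left _ _)
  have hNsplit : (N : ℝ) ^ (ε / 2) * (N : ℝ) ^ (2 + ε / 2) = (N : ℝ) ^ (2 + ε) := by
    rw [← Real.rpow_add hNpos]; ring_nf
  calc ((x : ℕ) : ℝ) * (P : ℝ)
      = (d : ℝ) * (((x / d : ℕ) : ℝ) * (P : ℝ)) := by rw [hsplit]; ring
    _ ≤ (max C₁ 0 * (N : ℝ) ^ (ε / 2) * (e : ℝ)) * (((x / d : ℕ) : ℝ) * (P : ℝ)) := by gcongr
    _ = max C₁ 0 * (N : ℝ) ^ (ε / 2) * (((x / d : ℕ) : ℝ) * (e : ℝ) * (P : ℝ)) := by ring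
    _ ≤ max C₁ 0 * (N : ℝ) ^ (ε / 2) * (max C₂ 0 * (N : ℝ) ^ (2 + ε / 2)) := by gcongr
    _ = max C₁ 0 * max C₂ 0 * (N : ℝ) ^ (2 + ε) := by rw [← hNsplit]; ring

/-- **Converse bookkeeping.**  For any selector `on ∣ cps ξ` and any `cap ≤ on` pointwise, `SteinbergCore`
implies the ledger core `(cps ξ / on) · cap · ∏_{q∣N} v_q(Δ_min) ≤ C N^(2+ε)` (with the same constant):
`(cps ξ / on) · cap ≤ (cps ξ / on) · on = cps ξ`.  So the residual stub of a ledger-type line is implied by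
the crux. -/
theorem ledgerCore_of_steinbergCore (on cap : ℤ → ℤ → ℕ → ℕ → ℕ)
    (hdvd : ∀ (a b : ℤ) (N Nm : ℕ), on a b N Nm ∣
      brandtXi (N / Nm) Nm (fun n => (freyCurve a b).LFunction n) /
        (ordProj[2] (brandtXi (N / Nm) Nm (fun n => (freyCurve a b).LFunction n)) *
          ordProj[3] (brandtXi (N / Nm) Nm (fun n => (freyCurve a b).LFunction n))))
    (hle : ∀ (a b : ℤ) (N Nm : ℕ), cap a b N Nm ≤ on a b N Nm)
    (hSC : Summit.ABC.ABC.Theses.DefiniteXi.SteinbergCore) :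
    ∀ ε : ℝ, 0 < ε → ∃ C : ℝ, ∀ a b : ℤ, IsCoprime a b → a * b * (a + b) ≠ 0 →
      ∀ (N : ℕ) [NeZero N], (freyCurve a b).conductorNorm ℤ = N →
      ∀ Nm : ℕ, Odd Nm → Squarefree Nm → Odd Nm.primeFactors.card → Nm ∣ N →
        ((brandtXi (N / Nm) Nm (fun n => (freyCurve a b).LFunction n) /
                (ordProj[2] (brandtXi (N / Nm) Nm (fun n => (freyCurve a b).LFunction n)) *
                  ordProj[3] (brandtXi (N / Nm) Nm (fun n => (freyCurve a b).LFunction n))) /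
              on a b N Nm : ℕ) : ℝ) * ((cap a b N Nm : ℕ) : ℝ) *
            ((∏ q ∈ N.primeFactors, ((freyCurve a b).minimalDiscriminantNorm ℤ).factorization q : ℕ) : ℝ) ≤
          C * (N : ℝ) ^ (2 + ε) := by
  intro ε hε
  obtain ⟨C, hC⟩ := hSC ε hε
  refine ⟨C, ?_⟩
  intro a b hab h0 N _ hN Nm hodd hsq hcard hdv
  have h := hC a b hab h0 N hN Nm hodd hsq hcard hdv
  set ξ : ℕ := brandtXi (N / Nm) Nm (fun n => (freyCurve a b).LFunction n) with hξ
  set x : ℕ := ξ / (ordProj[2] ξ * ordProj[3] ξ) with hx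
  set P : ℕ := ∏ q ∈ N.primeFactors, ((freyCurve a b).minimalDiscriminantNorm ℤ).factorization q with hP
  have hmain : ((x / on a b N Nm : ℕ) : ℝ) * ((cap a b N Nm : ℕ) : ℝ) ≤ ((x : ℕ) : ℝ) := by
    have : (x / on a b N Nm) * cap a b N Nm ≤ x :=
      calc (x / on a b N Nm) * cap a b N Nm ≤ (x / on a b N Nm) * on a b N Nm :=
            Nat.mul_le_mul_left _ (hle a b N Nm)
        _ = x := Nat.div_mul_cancel (hdvd a b N Nm)
    exact_mod_cast this
  have hPnn : (0 : ℝ) ≤ (P : ℝ) := by positivity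
  calc ((x / on a b N Nm : ℕ) : ℝ) * ((cap a b N Nm : ℕ) : ℝ) * (P : ℝ)
      ≤ ((x : ℕ) : ℝ) * (P : ℝ) := by gcongr
    _ ≤ C * (N : ℝ) ^ (2 + ε) := h

end Summit.ABC.ABC.Theorems
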